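import Summits.CriticalPhenomena.CardyFormulaZ2.Theorems.CardyMagicRigidityNestingRigidityNeckHookStarSandwich
import HarnessLib

/-!
# Virtual edges and the first bad link of a fuzzy hook-up (stub S11, road map item 1, first step for `𝔄`)

`vEdges` (attachments at resolution `ℓ`), `steps`, the refinement `exists_stepChain_of_tHookStar` of `THookStar ∖ THook` to a
step chain between non-connected crossings, and `exists_false_vEdge`.
-/

noncomputable section

namespace Summit.CriticalPhenomena.CardyFormulaZ2.Cruxes.NestingRigidity.PinchResampling

open MeasureTheory Set Literature.Probability.Percolation Literature.Probability.LatticeModels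
open scoped symmDiff

/-! ### Road map item 1, first step for `𝔄`: virtual edges, step chains, and the first bad link -/

section BadLink

/-- **Virtual edges** (attachments at resolution `ℓ`, true or false): pairs `(a, b)` with `a` an open interior site
`𝕋`-adjacent to an inner-layer vertex in the SAME `ℓ`-cell as `b`, and `b` an open inner-layer site whose blob is big. -/
def vEdges (ℓ lam s : ℕ) (x o : Site 2) (η : SiteConfig (Site 2)) : Set (Site 2 × Site 2) :=
  {q | q.1 ∈ η ∧ q.1 ∈ tBall x s ∧ q.2 ∈ η ∧ q.2 ∈ innerLayer triGraph (tBall x s) (tBall x (2 * s)) ∧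
    (∃ w ∈ blobOf (tColourGraph η true) (tBall x (2 * s) \ tBall x s) q.2,
      ∃ w' ∈ blobOf (tColourGraph η true) (tBall x (2 * s) \ tBall x s) q.2, (lam : ℤ) ≤ triNorm (w - w')) ∧
    ∃ w' ∈ innerLayer triGraph (tBall x s) (tBall x (2 * s)), triGraph.Adj q.1 w' ∧ cellOf ℓ o w' = cellOf ℓ o q.2}

/-- **Steps**: real open edges of `Λ_{2s}(x)`, or virtual edges in either orientation. -/
def steps (ℓ lam s : ℕ) (x o : Site 2) (η : SiteConfig (Site 2)) : Set (Site 2 × Site 2) :=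
  {q | ((tColourGraph η true).Adj q.1 q.2 ∧ q.1 ∈ tBall x (2 * s) ∧ q.2 ∈ tBall x (2 * s)) ∨
    q ∈ vEdges ℓ lam s x o η ∨ (q.2, q.1) ∈ vEdges ℓ lam s x o η}

variable {ℓ lam s : ℕ} {x o : Site 2} {η : SiteConfig (Site 2)}

/-- Members of the blob of an open site are open. -/
theorem mem_of_mem_blobOf {A : Set (Site 2)} {v b : Site 2} (hv : v ∈ η) (hb : b ∈ blobOf (tColourGraph η true) A v) :
    b ∈ η := by
  by_cases hbv : b = v
  · exact hbv ▸ hv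
  · rw [tColourGraph_true] at hb
    exact NeckCoarse.mem_of_pathIn_ne (PathIn.symm hb) hbv

/-- Members of a blob with two distinct members are open. -/
theorem mem_of_mem_blobOf_of_ne {A : Set (Site 2)} {v b w₁ w₂ : Site 2} (hw₁ : w₁ ∈ blobOf (tColourGraph η true) A v)
    (hw₂ : w₂ ∈ blobOf (tColourGraph η true) A v) (hne : w₁ ≠ w₂) (hb : b ∈ blobOf (tColourGraph η true) A v) : b ∈ η := by
  rw [tColourGraph_true] at hw₁ hw₂ hb
  by_cases h1 : b = w₁
  · subst h1
    exact NeckCoarse.mem_of_pathIn_ne ((PathIn.symm hb).trans hw₂) hne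
  · exact NeckCoarse.mem_of_pathIn_ne ((PathIn.symm hb).trans hw₁) h1

/-- A real open path inside a subset of `Λ_{2s}(x)` is a step chain. -/
theorem stepChain_of_pathIn {B : Set (Site 2)} (hB : B ⊆ tBall x (2 * s)) {u v : Site 2}
    (hp : PathIn (tColourGraph η true) B u v) :
    Relation.ReflTransGen (fun a b ↦ (a, b) ∈ steps ℓ lam s x o η) u v := by
  obtain ⟨hu, p⟩ := hp
  induction p with
  | refl => exact Relation.ReflTransGen.refl
  | @tail b c hab hbc ih =>
    have hb : b ∈ B := PathIn.right_mem (show PathIn (tColourGraph η true) B u b from ⟨hu, hab⟩)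
    exact ih.tail (Or.inl ⟨hbc.1, hB hb, hB hbc.2⟩)

/-- A toucher of the coarse footprint of a big blob is virtually attached to an inner-layer site of that blob. -/
theorem exists_vEdge_of_mem_touchers (hlam : 1 ≤ lam) {v u : Site 2}
    (hbig : ∃ w ∈ blobOf (tColourGraph η true) (tBall x (2 * s) \ tBall x s) v,
      ∃ w' ∈ blobOf (tColourGraph η true) (tBall x (2 * s) \ tBall x s) v, (lam : ℤ) ≤ triNorm (w - w'))
    (hu : u ∈ touchers ℓ s x o η (cellOf ℓ o '' (blobOf (tColourGraph η true) (tBall x (2 * s) \ tBall x s) v ∩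
      innerLayer triGraph (tBall x s) (tBall x (2 * s))))) :
    ∃ b ∈ blobOf (tColourGraph η true) (tBall x (2 * s) \ tBall x s) v, (u, b) ∈ vEdges ℓ lam s x o η := by
  obtain ⟨huη, huK, w', hw'L, hadj, ⟨b, ⟨hbv, hbL⟩, hcell⟩⟩ := hu
  obtain ⟨w₁, hw₁, w₂, hw₂, hd⟩ := hbig
  have hne : w₁ ≠ w₂ := by
    rintro rfl
    simp [triNorm] at hd
    omega
  have hbη : b ∈ η := mem_of_mem_blobOf_of_ne hw₁ hw₂ hne hbv
  refine ⟨b, hbv, huη, huK, hbη, hbL, ?_, w', hw'L, hadj, hcell.symm⟩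
  rw [NeckCoarse.blobOf_eq_of_mem hbv]
  exact ⟨w₁, hw₁, w₂, hw₂, hd⟩

/-- A fuzzy step is a step chain (the blob of a footprint really joins any two of its cells). -/
theorem stepChain_of_starPair (hlam : 1 ≤ lam) {p q : Site 2}
    (h : (p, q) ∈ starPairs ℓ s x o (tCoarse ℓ lam s x o η) η) :
    Relation.ReflTransGen (fun a b ↦ (a, b) ∈ steps ℓ lam s x o η) p q := by
  have hKO : tBall x s ⊆ tBall x (2 * s) := fun v hv ↦ by
    simp only [tBall, mem_setOf_eq] at hv ⊢; push_cast; omega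
  rcases h with ⟨hp, hpK, hq, hqK, hadj⟩ | ⟨S, hS, hpS, hqS⟩
  · refine Relation.ReflTransGen.single (Or.inl ⟨?_, hKO hpK, hKO hqK⟩)
    rw [tColourGraph_true, siteOpenGraph_adj]; exact ⟨hadj, hp, hq⟩
  · -- a blob `blob v` with footprint `S`, big and inner-touching
    have hS' : ∃ v ∈ innerLayer triGraph (tBall x s) (tBall x (2 * s)),
        (∃ w ∈ blobOf (tColourGraph η true) (tBall x (2 * s) \ tBall x s) v,
          ∃ w' ∈ blobOf (tColourGraph η true) (tBall x (2 * s) \ tBall x s) v, (lam : ℤ) ≤ triNorm (w - w')) ∧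
        S = cellOf ℓ o '' (blobOf (tColourGraph η true) (tBall x (2 * s) \ tBall x s) v ∩
          innerLayer triGraph (tBall x s) (tBall x (2 * s))) := by
      rcases hS with ⟨v, hvL, hbig, -, hSv⟩ | ⟨v, hvL, hbig, -, hSv⟩ <;> exact ⟨v, hvL, hbig, hSv⟩
    obtain ⟨v, -, hbig, rfl⟩ := hS'
    obtain ⟨bp, hbp, hep⟩ := exists_vEdge_of_mem_touchers hlam hbig hpS
    obtain ⟨bq, hbq, heq⟩ := exists_vEdge_of_mem_touchers hlam hbig hqS
    have hpath : PathIn (tColourGraph η true) (tBall x (2 * s) \ tBall x s) bp bq := (PathIn.symm hbp).trans hbq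
    have h1 : Relation.ReflTransGen (fun a b ↦ (a, b) ∈ steps ℓ lam s x o η) p bp :=
      Relation.ReflTransGen.single (Or.inr (Or.inl hep))
    exact (h1.trans (stepChain_of_pathIn Set.sdiff_subset hpath)).tail (Or.inr (Or.inr heq))

/-- A fuzzy chain is a step chain. -/
theorem stepChain_of_starChain (hlam : 1 ≤ lam) {p q : Site 2}
    (h : Relation.ReflTransGen (fun a b ↦ (a, b) ∈ starPairs ℓ s x o (tCoarse ℓ lam s x o η) η) p q) :
    Relation.ReflTransGen (fun a b ↦ (a, b) ∈ steps ℓ lam s x o η) p q := by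
  induction h with
  | refl => exact Relation.ReflTransGen.refl
  | tail _ hpq ih => exact ih.trans (stepChain_of_starPair hlam hpq)

/-- **Refinement of `𝔄` (road map, item 1, first step).**  On `THookStar ∖ THook` (with `1 ≤ lam`, `lam + 1 ≤ s`; `TPinch` is not
even needed)
there are inner-layer sites `b, b'` of the two open crossing clusters, NOT joined by an open path of `Λ_{2s}(x)`, but
joined by a chain of steps (real open edges and virtual edges). -/
theorem exists_stepChain_of_tHookStar (hlam : 1 ≤ lam) (hls : lam + 1 ≤ s)
    (hS : η ∈ THookStar ℓ lam s x o) (hnH : η ∉ THook x x s s) :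
    ∃ b b', IsCrossing triGraph (tColourGraph η true) (tBall x s) (tBall x (2 * s)) b ∧
      IsCrossing triGraph (tColourGraph η true) (tBall x s) (tBall x (2 * s)) b' ∧
      ¬ PathIn (tColourGraph η true) (tBall x (2 * s)) b b' ∧
      Relation.ReflTransGen (fun a c ↦ (a, c) ∈ steps ℓ lam s x o η) b b' := by
  set K := tBall x s with hK
  set O := tBall x (2 * s) with hO
  set H := tColourGraph η true with hH
  -- two crossings not hooked up
  have hvw : ∃ v w, IsCrossing triGraph H K O v ∧ IsCrossing triGraph H K O w ∧ ¬ PathIn H O v w := by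
    by_contra hcon
    push Not at hcon
    exact hnH fun v w hv hw ↦ hcon v w hv hw
  obtain ⟨v, w, hv, hw, hnvw⟩ := hvw
  -- crossing blobs are big and crossing: their footprints are in `σ.1`
  have hbigc : ∀ {v : Site 2}, IsCrossing triGraph H K O v →
      (∃ w₁ ∈ blobOf H (O \ K) v, ∃ w₂ ∈ blobOf H (O \ K) v, (lam : ℤ) ≤ triNorm (w₁ - w₂)) ∧
      (∃ w₁ ∈ blobOf H (O \ K) v, w₁ ∈ outerLayer triGraph K O) := by
    rintro v ⟨hvL, w₁, hw₁o, hp⟩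
    refine ⟨⟨w₁, hp, v, NeckCoarse.self_mem_blobOf hvL.1, ?_⟩, w₁, hp, hw₁o⟩
    have h1 := triNorm_le_of_mem_innerLayer hvL
    have h2 := le_triNorm_of_mem_outerLayer hw₁o
    have h3 := triNorm_sub_le_triNorm_sub_add w₁ v x
    push_cast at h2
    omega
  have hmem : ∀ {v : Site 2}, IsCrossing triGraph H K O v →
      cellOf ℓ o '' (blobOf H (O \ K) v ∩ innerLayer triGraph K O) ∈ (tCoarse ℓ lam s x o η).1 :=
    fun {v} hv ↦ ⟨v, hv.1, (hbigc hv).1, (hbigc hv).2, rfl⟩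
  obtain ⟨u, hu, u', hu', hchain⟩ := hS _ (hmem hv) _ (hmem hw)
  obtain ⟨b, hbv, heb⟩ := exists_vEdge_of_mem_touchers hlam (hbigc hv).1 hu
  obtain ⟨b', hb'w, heb'⟩ := exists_vEdge_of_mem_touchers hlam (hbigc hw).1 hu'
  have hbL : b ∈ innerLayer triGraph K O := heb.2.2.2.1
  have hb'L : b' ∈ innerLayer triGraph K O := heb'.2.2.2.1
  refine ⟨b, b', ⟨hbL, ?_⟩, ⟨hb'L, ?_⟩, fun hbb' ↦ hnvw ?_, ?_⟩
  · obtain ⟨-, w₁, hw₁o, hp⟩ := hv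
    exact ⟨w₁, hw₁o, (PathIn.symm hbv).trans hp⟩
  · obtain ⟨-, w₁, hw₁o, hp⟩ := hw
    exact ⟨w₁, hw₁o, (PathIn.symm hb'w).trans hp⟩
  · exact ((hbv.mono Set.sdiff_subset).trans hbb').trans ((PathIn.symm hb'w).mono Set.sdiff_subset)
  · have h1 : Relation.ReflTransGen (fun a c ↦ (a, c) ∈ steps ℓ lam s x o η) b u :=
      Relation.ReflTransGen.single (Or.inr (Or.inr heb))
    exact (h1.trans (stepChain_of_starChain hlam hchain)).tail (Or.inr (Or.inl heb'))

/-- **The first bad link (road map, item 1, `k = 1` skeleton of `𝔄`).**  On `THookStar ∖ THook` some virtual edge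
is FALSE in the strong sense: an open interior site `a`, within one cell of an open inner-layer site `c` of a BIG blob,
with `a` and `c` in distinct open clusters of `Λ_{2s}(x)` — two distinct open clusters of the big ball, one containing a
blob of diameter `≥ lam`, come within `𝕋`-distance `2ℓ` of each other at the inner layer. -/
theorem exists_false_vEdge (hlam : 1 ≤ lam) (hls : lam + 1 ≤ s)
    (hS : η ∈ THookStar ℓ lam s x o) (hnH : η ∉ THook x x s s) :
    ∃ a c, (a, c) ∈ vEdges ℓ lam s x o η ∧ ¬ PathIn (tColourGraph η true) (tBall x (2 * s)) a c := by
  obtain ⟨b, b', hb, -, hnbb', hchain⟩ := exists_stepChain_of_tHookStar hlam hls hS hnH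
  by_contra hcon
  push Not at hcon
  have key : ∀ z, Relation.ReflTransGen (fun a c ↦ (a, c) ∈ steps ℓ lam s x o η) b z →
      PathIn (tColourGraph η true) (tBall x (2 * s)) b z := by
    intro z hz
    induction hz with
    | refl => exact PathIn.refl hb.1.1.1
    | @tail y z _ hyz ih =>
      rcases hyz with ⟨hadj, -, hzO⟩ | hv | hv
      · exact ih.tail hadj hzO
      · exact ih.trans (hcon y z hv)
      · exact ih.trans (PathIn.symm (hcon z y hv))
  exact hnbb' (key b' hchain)

/-- **The first bad link, closed form** (anchor of this module; all parameters explicit): on `THookStar ∖ THook` in the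
window `1 ≤ lam`, `lam + 1 ≤ s`, some virtual edge joins two distinct open clusters of `Λ_{2s}(x)`. -/
theorem exists_false_vEdge_of_tHookStar : ∀ (ℓ lam s : ℕ) (x o : Site 2) (η : SiteConfig (Site 2)), 1 ≤ lam → lam + 1 ≤ s → η ∈ THookStar ℓ lam s x o → η ∉ THook x x s s → ∃ a c : Site 2, (a, c) ∈ vEdges ℓ lam s x o η ∧ ¬ PathIn (tColourGraph η true) (tBall x (2 * s)) a c :=
  fun _ _ _ _ _ _ hlam hls hS hnH ↦ exists_false_vEdge hlam hls hS hnH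

end BadLink

end Summit.CriticalPhenomena.CardyFormulaZ2.Cruxes.NestingRigidity.PinchResampling

end
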